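import Mathlib
import Summits.NavierStokesRegularity.NavierStokesRegularity.Theorems.SubOnsagerCeilingVirtualFloorChainCoupledFace
import Summits.NavierStokesRegularity.NavierStokesRegularity.Theorems.SubOnsagerCeilingGapBridge
import Summits.NavierStokesRegularity.NavierStokesRegularity.Theorems.SubOnsagerCeilingGapCertCSmall
import Summits.NavierStokesRegularity.NavierStokesRegularity.Theorems.SubOnsagerCeilingGapCertCBulk
import Summits.NavierStokesRegularity.NavierStokesRegularity.Theorems.SubOnsagerCeilingGapCertCDamp
import Summits.NavierStokesRegularity.NavierStokesRegularity.Theorems.SubOnsagerCeilingGapCertCCarve1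
import Summits.NavierStokesRegularity.NavierStokesRegularity.Theorems.SubOnsagerCeilingGapCertCCarve2
import Summits.NavierStokesRegularity.NavierStokesRegularity.Theorems.SubOnsagerCeilingGapCertCCarve3
import HarnessLib

/-!
# RUNG 10, slice C: the chain barrier `θ = 101/200` at every `b ∈ [77/50, 25/16]` from the d45 certificates
(helper file for crux stmt-NavierStokesRegularity-27057 `SubOnsagerCeiling.ForwardTailCeilingKP`, `--supports … --as helper`;
LEAD SOC g11, line «kp-shell-barrier»)

Assembly for the slice `b ∈ [77/50, 25/16]` of the gap below `b = 25/16`: (i) the rescaling constants `L = b^(5/2)/b^(101/200) = b^(399/200)`,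
`p = b^(5/2)/(b^(101/200))³ = b^(197/200)`, `b²` lie in the rational box of the slice's certificates (`sliceC_consts`, by comparing
`200`-th powers); (ii) the `hFace` hypothesis of `VirtualFloor.chain_le_of_coupledFaceCertB` (p689309) for the face family «d45»
(`SubOnsagerCeilingGapFaces`) at every such `b`, from the kernel certificates `cert_C_*` (files `SubOnsagerCeilingGapCertC*`) through
the bridge `inertial_of_cert` / `damping_of_cert` (`SubOnsagerCeilingGapBridge`), the carve floor's inertial condition by the kd case split
of its 3 certificate parts (`Box.mem_split`), the structural damping signs by `face_damping_easy`; (iii) the chain barrier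
`(b^(101/200))^(2k) Z_k(t)² ≤ 100 x₀²` along every honest non-negative `ν`-viscous Katz–Pavlović chain from a one-shell datum
(`gap_chain_C`). HONEST FRAMING: MODEL lattice (route SubOnsagerCeiling, TL-M2Break); nothing here bears on Navier–Stokes regularity;
27057 stays OPEN. [cite: BarbatoMorandinRomito2011, §2 Lemma 2.1, §3.2] [cite: Tao2016AveragedNS, §4 (4.5), (4.13)]
-/

noncomputable section

-- the sub-problem namespace `NavierStokesRegularity.NavierStokesRegularity` is the tree's layout (D-0017)
set_option linter.dupNamespace false

namespace Summit.NavierStokesRegularity.NavierStokesRegularity.Theorems.VirtualFloor.GapRung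

open Set Filter Topology
open Literature.Analysis.ValidatedNumerics KernelFaceMul KernelFaceAffine
open Summit.NavierStokesRegularity.NavierStokesRegularity.Theorems.VirtualFloor

/-! ## Numerical facts: the rescaling constants of the slice lie in the certificates' box -/

/-- `29581/12500 ≤ (77/50)^(399/200)`. [folklore] -/
theorem sliceC_L_lo : ((29581 / 12500 : ℚ) : ℝ) ≤ (77 / 50 : ℝ) ^ ((399 : ℝ) / 200) := by
  have h0 : (0 : ℝ) ≤ (77 / 50 : ℝ) ^ ((399 : ℝ) / 200) := by positivity
  have h2 : ((77 / 50 : ℝ) ^ ((399 : ℝ) / 200)) ^ (200 : ℕ) = (77 / 50 : ℝ) ^ (399 : ℕ) := by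
    rw [← Real.rpow_natCast, ← Real.rpow_mul (by norm_num)]
    norm_num
  have hq : ¬ ((77 / 50 : ℚ) ^ (399 : ℕ) < (29581 / 12500 : ℚ) ^ (200 : ℕ)) := by decide +kernel
  have hr : ¬ ((((77 / 50 : ℚ) ^ (399 : ℕ) : ℚ) : ℝ) < (((29581 / 12500 : ℚ) ^ (200 : ℕ) : ℚ) : ℝ)) := by
    rw [Rat.cast_lt]; exact hq
  push_cast at hr
  push_cast
  by_contra h
  push Not at h
  have h3 : ((77 / 50 : ℝ) ^ ((399 : ℝ) / 200)) ^ (200 : ℕ) < (29581 / 12500 : ℝ) ^ (200 : ℕ) :=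
    pow_lt_pow_left₀ h h0 (by norm_num)
  rw [h2] at h3
  exact hr h3

/-- `(25/16)^(399/200) ≤ 243597/100000`. [folklore] -/
theorem sliceC_L_hi : (25 / 16 : ℝ) ^ ((399 : ℝ) / 200) ≤ ((243597 / 100000 : ℚ) : ℝ) := by
  have h0 : (0 : ℝ) ≤ (25 / 16 : ℝ) ^ ((399 : ℝ) / 200) := by positivity
  have h2 : ((25 / 16 : ℝ) ^ ((399 : ℝ) / 200)) ^ (200 : ℕ) = (25 / 16 : ℝ) ^ (399 : ℕ) := by
    rw [← Real.rpow_natCast, ← Real.rpow_mul (by norm_num)]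
    norm_num
  have hq : ¬ ((243597 / 100000 : ℚ) ^ (200 : ℕ) < (25 / 16 : ℚ) ^ (399 : ℕ)) := by decide +kernel
  have hr : ¬ ((((243597 / 100000 : ℚ) ^ (200 : ℕ) : ℚ) : ℝ) < (((25 / 16 : ℚ) ^ (399 : ℕ) : ℚ) : ℝ)) := by
    rw [Rat.cast_lt]; exact hq
  push_cast at hr
  push_cast
  by_contra h
  push Not at h
  have h3 : (243597 / 100000 : ℝ) ^ (200 : ℕ) < ((25 / 16 : ℝ) ^ ((399 : ℝ) / 200)) ^ (200 : ℕ) :=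
    pow_lt_pow_left₀ h (by norm_num) (by norm_num)
  rw [h2] at h3
  exact hr h3

/-- `30601/20000 ≤ (77/50)^(197/200)`. [folklore] -/
theorem sliceC_p_lo : ((30601 / 20000 : ℚ) : ℝ) ≤ (77 / 50 : ℝ) ^ ((197 : ℝ) / 200) := by
  have h0 : (0 : ℝ) ≤ (77 / 50 : ℝ) ^ ((197 : ℝ) / 200) := by positivity
  have h2 : ((77 / 50 : ℝ) ^ ((197 : ℝ) / 200)) ^ (200 : ℕ) = (77 / 50 : ℝ) ^ (197 : ℕ) := by
    rw [← Real.rpow_natCast, ← Real.rpow_mul (by norm_num)]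
    norm_num
  have hq : ¬ ((77 / 50 : ℚ) ^ (197 : ℕ) < (30601 / 20000 : ℚ) ^ (200 : ℕ)) := by decide +kernel
  have hr : ¬ ((((77 / 50 : ℚ) ^ (197 : ℕ) : ℚ) : ℝ) < (((30601 / 20000 : ℚ) ^ (200 : ℕ) : ℚ) : ℝ)) := by
    rw [Rat.cast_lt]; exact hq
  push_cast at hr
  push_cast
  by_contra h
  push Not at h
  have h3 : ((77 / 50 : ℝ) ^ ((197 : ℝ) / 200)) ^ (200 : ℕ) < (30601 / 20000 : ℝ) ^ (200 : ℕ) :=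
    pow_lt_pow_left₀ h h0 (by norm_num)
  rw [h2] at h3
  exact hr h3

/-- `(25/16)^(197/200) ≤ 19401/12500`. [folklore] -/
theorem sliceC_p_hi : (25 / 16 : ℝ) ^ ((197 : ℝ) / 200) ≤ ((19401 / 12500 : ℚ) : ℝ) := by
  have h0 : (0 : ℝ) ≤ (25 / 16 : ℝ) ^ ((197 : ℝ) / 200) := by positivity
  have h2 : ((25 / 16 : ℝ) ^ ((197 : ℝ) / 200)) ^ (200 : ℕ) = (25 / 16 : ℝ) ^ (197 : ℕ) := by
    rw [← Real.rpow_natCast, ← Real.rpow_mul (by norm_num)]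
    norm_num
  have hq : ¬ ((19401 / 12500 : ℚ) ^ (200 : ℕ) < (25 / 16 : ℚ) ^ (197 : ℕ)) := by decide +kernel
  have hr : ¬ ((((19401 / 12500 : ℚ) ^ (200 : ℕ) : ℚ) : ℝ) < (((25 / 16 : ℚ) ^ (197 : ℕ) : ℚ) : ℝ)) := by
    rw [Rat.cast_lt]; exact hq
  push_cast at hr
  push_cast
  by_contra h
  push Not at h
  have h3 : (19401 / 12500 : ℝ) ^ (200 : ℕ) < ((25 / 16 : ℝ) ^ ((197 : ℝ) / 200)) ^ (200 : ℕ) :=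
    pow_lt_pow_left₀ h (by norm_num) (by norm_num)
  rw [h2] at h3
  exact hr h3

/-- The rescaling constants at `b ∈ [77/50, 25/16]` lie in the slice box: `L = b^(399/200) ∈ [29581/12500, 243597/100000]`,
`p = b^(197/200) ∈ [30601/20000, 19401/12500]`, `b² ∈ [5929/2500, 625/256]`. [folklore] -/
theorem sliceC_consts {b : ℝ} (hb : (77 / 50 : ℝ) ≤ b) (hb' : b ≤ (25 / 16 : ℝ)) :
    (((29581 / 12500 : ℚ) : ℝ) ≤ (b ^ ((5 : ℝ) / 2) / b ^ ((101 : ℝ) / 200)) ∧ (b ^ ((5 : ℝ) / 2) / b ^ ((101 : ℝ) / 200)) ≤ ((243597 / 100000 : ℚ) : ℝ)) ∧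
    (((30601 / 20000 : ℚ) : ℝ) ≤ (b ^ ((5 : ℝ) / 2) / (b ^ ((101 : ℝ) / 200)) ^ 3) ∧ (b ^ ((5 : ℝ) / 2) / (b ^ ((101 : ℝ) / 200)) ^ 3) ≤ ((19401 / 12500 : ℚ) : ℝ)) ∧
    (((5929 / 2500 : ℚ) : ℝ) ≤ b ^ 2 ∧ b ^ 2 ≤ ((625 / 256 : ℚ) : ℝ)) := by
  have hb0 : 0 < b := by linarith
  have hL : (b ^ ((5 : ℝ) / 2) / b ^ ((101 : ℝ) / 200)) = b ^ ((399 : ℝ) / 200) := by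
    rw [← Real.rpow_sub hb0]; norm_num
  have hp : (b ^ ((5 : ℝ) / 2) / (b ^ ((101 : ℝ) / 200)) ^ 3) = b ^ ((197 : ℝ) / 200) := by
    rw [← Real.rpow_natCast, ← Real.rpow_mul hb0.le, ← Real.rpow_sub hb0]; norm_num
  rw [hL, hp]
  refine ⟨⟨sliceC_L_lo.trans (Real.rpow_le_rpow (by norm_num) hb (by norm_num)),
    (Real.rpow_le_rpow hb0.le hb' (by norm_num)).trans sliceC_L_hi⟩,
    ⟨sliceC_p_lo.trans (Real.rpow_le_rpow (by norm_num) hb (by norm_num)),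
    (Real.rpow_le_rpow hb0.le hb' (by norm_num)).trans sliceC_p_hi⟩, ?_, ?_⟩
  · push_cast; nlinarith
  · push_cast; nlinarith

/-! ## The `hFace` hypothesis at every `b` of the slice -/

/-- **`hFace` for the family «d45» at every `b ∈ [77/50, 25/16]`**: on each active face, the strict inertial inequality along the
coupled field and the damping sign condition (kernel certificates + bridge + structural damping). [cite: BarbatoMorandinRomito2011, §2 Lemma 2.1] -/
theorem sliceC_hFace {b : ℝ} (hb : (77 / 50 : ℝ) ≤ b) (hb' : b ≤ (25 / 16 : ℝ)) :
    ∀ k (x : Fin 4 → ℝ) (v z : ℝ), (∀ i, 0 ≤ x i) → 0 ≤ v → 0 ≤ z → (∀ i, x i ≤ (49 / 50 : ℝ)) → v ≤ (49 / 50 : ℝ) →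
      z ≤ (49 / 50 : ℝ) → (∀ k', face k' x ≤ 0) → (∀ k', face k' (vec4 v (x 0) (x 1) (x 2)) ≤ 0) →
      (∀ k', face k' (vec4 (x 1) (x 2) (x 3) z) ≤ 0) → face k x = 0 →
      (faceGrad k 0 x * (v ^ 2 - (b ^ ((5 : ℝ) / 2) / (b ^ ((101 : ℝ) / 200)) ^ 3) * x 0 * x 1) +
          faceGrad k 1 x * ((b ^ ((5 : ℝ) / 2) / b ^ ((101 : ℝ) / 200)) * (x 0 ^ 2 - (b ^ ((5 : ℝ) / 2) / (b ^ ((101 : ℝ) / 200)) ^ 3) * x 1 * x 2)) +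
          faceGrad k 2 x * ((b ^ ((5 : ℝ) / 2) / b ^ ((101 : ℝ) / 200)) ^ 2 * (x 1 ^ 2 - (b ^ ((5 : ℝ) / 2) / (b ^ ((101 : ℝ) / 200)) ^ 3) * x 2 * x 3)) +
          faceGrad k 3 x * ((b ^ ((5 : ℝ) / 2) / b ^ ((101 : ℝ) / 200)) ^ 3 * (x 2 ^ 2 - (b ^ ((5 : ℝ) / 2) / (b ^ ((101 : ℝ) / 200)) ^ 3) * x 3 * z)) < 0) ∧
      0 ≤ faceGrad k 0 x * x 0 + faceGrad k 1 x * ((b ^ 2) * x 1) + faceGrad k 2 x * ((b ^ 2) ^ 2 * x 2) +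
        faceGrad k 3 x * ((b ^ 2) ^ 3 * x 3) := by
  intro k x v z h0 hv0 hz0 hc hvc hzc hX hLo hUp hk
  obtain ⟨hL, hp, hb2⟩ := sliceC_consts hb hb'
  have hmem := pt_mem_box9 h0 hc hv0 hvc hz0 hzc hL hp hb2
  refine ⟨inertial_real_of_eval (b2 := b ^ 2) ?_, ?_⟩
  · cases k
    · exact inertial_of_cert cert_C_cap1 hmem h0 hc hX hLo hUp hk
    · exact inertial_of_cert cert_C_cap2 hmem h0 hc hX hLo hUp hk
    · exact inertial_of_cert cert_C_cap3 hmem h0 hc hX hLo hUp hk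
    · exact inertial_of_cert cert_C_cub0 hmem h0 hc hX hLo hUp hk
    · exact inertial_of_cert cert_C_cub1 hmem h0 hc hX hLo hUp hk
    · exact inertial_of_cert cert_C_cub2 hmem h0 hc hX hLo hUp hk
    · exact inertial_of_cert cert_C_capA hmem h0 hc hX hLo hUp hk
    · exact inertial_of_cert cert_C_capB hmem h0 hc hX hLo hUp hk
    · exact inertial_of_cert cert_C_bulk hmem h0 hc hX hLo hUp hk
    · rcases Box.mem_split hmem 2 (49/100) with hmem' | hmem'
      · exact inertial_of_cert cert_C_carve_1 hmem' h0 hc hX hLo hUp hk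
      · rcases Box.mem_split hmem' 2 (147/200) with hmem'' | hmem''
        · exact inertial_of_cert cert_C_carve_2 hmem'' h0 hc hX hLo hUp hk
        · exact inertial_of_cert cert_C_carve_3 hmem'' h0 hc hX hLo hUp hk
  · have hB20 : (0 : ℝ) ≤ b ^ 2 := by positivity
    have hB23 : b ^ 2 ≤ 3 := by nlinarith
    cases k
    · exact face_damping_easy x (b ^ 2) h0 hB20 hB23 .cap1 (by decide) (by decide) hk
    · exact face_damping_easy x (b ^ 2) h0 hB20 hB23 .cap2 (by decide) (by decide) hk
    · exact face_damping_easy x (b ^ 2) h0 hB20 hB23 .cap3 (by decide) (by decide) hk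
    · exact face_damping_easy x (b ^ 2) h0 hB20 hB23 .cub0 (by decide) (by decide) hk
    · exact face_damping_easy x (b ^ 2) h0 hB20 hB23 .cub1 (by decide) (by decide) hk
    · exact face_damping_easy x (b ^ 2) h0 hB20 hB23 .cub2 (by decide) (by decide) hk
    · exact face_damping_easy x (b ^ 2) h0 hB20 hB23 .capA (by decide) (by decide) hk
    · exact face_damping_easy x (b ^ 2) h0 hB20 hB23 .capB (by decide) (by decide) hk
    · exact damping_of_cert cert_C_bulk_damp hmem h0 hc hX hLo hUp hk
    · exact damping_of_cert cert_C_carve_damp hmem h0 hc hX hLo hUp hk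

/-! ## The chain barrier on the slice -/

/-- **The ν-uniform chain barrier `θ = 101/200` at every `b ∈ [77/50, 25/16]`**: along every honest non-negative `ν`-viscous solution
of the Katz–Pavlović chain (couplings `c₀ b^(5k/2)`, damping `ν b^(2k)`) from the one-shell datum `x₀`,
`(b^(101/200))^(2k) Z_k(t)² ≤ 100 x₀²`. Via `chain_le_of_coupledFaceCertB` with the family «d45».
[cite: BarbatoMorandinRomito2011, §3.2 (the rescaling)] [cite: Tao2016AveragedNS, §4 (4.5), (4.13)] -/
theorem gap_chain_C {b c₀ ν s x₀ : ℝ} (hb : (77 / 50 : ℝ) ≤ b) (hb' : b ≤ (25 / 16 : ℝ)) (hc₀ : 0 < c₀)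
    (hν : 0 < ν) (hs : 0 < s) {Z : ℤ → ℝ → ℝ}
    (hdat : ∀ k : ℤ, Z k 0 = if k = 0 then x₀ else 0)
    (hvan : ∀ t, Z (-1) t = 0)
    (hbdd : ∃ M : ℝ, ∀ (t : ℝ) (k : ℕ), (1 + b ^ ((10 : ℝ) * k)) * |Z k t| ≤ M)
    (hcont : ∀ k : ℕ, ContinuousOn (Z k) (Icc 0 s))
    (hode : ∀ k : ℕ, ∀ t ∈ Icc 0 s, HasDerivWithinAt (Z k)
      (c₀ * (b ^ ((5 : ℝ) * ((k : ℝ) - 1) / 2) * Z ((k : ℤ) - 1) t ^ 2 -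
          b ^ ((5 : ℝ) * (k : ℝ) / 2) * (Z k t * Z ((k : ℤ) + 1) t)) -
        ν * b ^ ((2 : ℝ) * (k : ℝ)) * Z k t) (Icc 0 s) t)
    (hnn : ∀ t ∈ Icc 0 s, ∀ k : ℕ, 1 ≤ k → 0 ≤ Z k t) :
    ∀ t ∈ Icc 0 s, ∀ k : ℕ, (b ^ ((101 : ℝ) / 200)) ^ (2 * k) * Z k t ^ 2 ≤ 100 * x₀ ^ 2 :=
  chain_le_of_coupledFaceCertB (by linarith) (by linarith) hc₀ (by norm_num : (49 / 50 : ℝ) ≤ 1) hν hs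
    face_continuous face_hasDerivWithinAt face_init face_safe (sliceC_hFace hb hb') hdat hvan hbdd hcont hode hnn

end Summit.NavierStokesRegularity.NavierStokesRegularity.Theorems.VirtualFloor.GapRung

end
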